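import Mathlib
import HarnessLib
import Literature.NumberTheory.LFunctions.MoebiusHarmonicSumBound
import Literature.NumberTheory.LFunctions.QuasiRHFactsProofs
import Literature.NumberTheory.LFunctions.LittlewoodCriterion

/-!
# Möbius sums against dilated profiles under a power bound `M(x) = O(x^α)`

Support file (everything PROVED, no named facts) for the proof of the named fact
`Literature.NumberTheory.LFunctions.horocycleRate_of_quasiRH` (`HorocycleRH.lean`; Zagier 1981,
§1 p. 279, (Z1)). The elementary proof of the quasi-RH rate for closed horocycles replaces the
meromorphic continuation of `E(z,s)` by Möbius cancellation in the unfolded sums, driven by the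
single arithmetic input `|M(t)| ≤ C t^α` (`M(t) = ∑_{k ≤ t} μ(k)`, `0 < α < 1`), which under
`QuasiRiemannHypothesis θ₀` holds with `α = θ₀ + ε` (tree:
`Literature.NumberTheory.LFunctions.mertens_isBigO_of_quasiRiemannHypothesis_holds`, Titchmarsh
Thm. 14.25 (A) ⇒ (C)). From this bound the file derives, by partial summation:

* `exists_mertens_bound_of_quasiRH` — the bound in the shape `∀ t ≥ 1, |∑_{k ≤ t} μ(k)| ≤ C t^{θ₀+ε}`;
* `abs_sum_moebius_div_le` — `|∑_{k ≤ x} μ(k)/k| ≤ C (1 + 1/(1-α)) x^{α-1}` (`x ≥ 1`), using the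
  tree's `∫_1^∞ M(t) t⁻² dt = 0` (`MoebiusHarmonicSumBound.lean`, i.e. `∑ μ(n)/n = 0`);
* `norm_tsum_moebius_div_sq_tail_le` — `|∑_{d > D} μ(d)/d²| ≤ 4 C D^{α-2}` (`D ≥ 1`);
* `norm_sum_moebius_mul_le` — for `F` differentiable on `[1, ∞)` with `‖F'(t)‖ ≤ A/t` and
  `F = 0` on `[X, ∞)`: `‖∑_{d ≤ n} μ(d) F(d)‖ ≤ C A X^α / α` (`n ≥ X ≥ 1`).

These are the classical consequences of `M(x) ≪ x^α` (Titchmarsh, *The Theory of the Riemann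
Zeta-Function*, §14.25–14.26; Montgomery–Vaughan, *Multiplicative Number Theory I*, §15.1).

## References
* E. C. Titchmarsh, *The Theory of the Riemann Zeta-Function*, 2nd ed. (1986), §14.25
  [Titchmarsh1986].
* D. Zagier, *Eisenstein series and the Riemann zeta function* (1981), §1 [Zagier1981].

## Mathlib / tree search
Mathlib: `sum_mul_eq_sub_sub_integral_mul'`, `sum_mul_eq_sub_integral_mul₀` (Abel summation),
`integral_Ioi_rpow_of_lt`, `integral_rpow`. Tree: `MoebiusSum.sum_moebius_div_eq`,
`MoebiusSum.integral_sum_div_sq_eq_zero`, `MoebiusSum.integrableOn_sum_div_sq`,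
`MoebiusSum.exists_abs_sum_Icc_moebius_le` (`MoebiusHarmonicSumBound.lean`),
`MertensDictionary.exists_bound_of_isBigO` (`LittlewoodCriterion.lean`).
-/

noncomputable section

open Real MeasureTheory Set Filter Finset
open scoped ArithmeticFunction.Moebius Topology

namespace Literature.NumberTheory.LFunctions

namespace MoebiusDilatedSums

/-! ### The input `|M(t)| ≤ C t^α` from quasi-RH -/

/-- `∑_{0 ≤ k ≤ n} μ(k) = M(n)` (`μ(0) = 0`). [folklore] -/
theorem sum_Icc_moebius_eq_mertensFunction (n : ℕ) :
    ∑ k ∈ Finset.Icc 0 n, (μ k : ℝ) = (LFunctions.mertensFunction (n : ℝ) : ℝ) := by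
  rw [MoebiusSum.sum_Icc_zero_moebius_eq_sum_Ioc, MertensDictionary.mertensFunction_natCast]
  push_cast
  rfl

/-- **Quasi-RH gives `|M(t)| ≤ C t^{θ₀+ε}` for all real `t ≥ 1`** (tree:
`mertens_isBigO_of_quasiRiemannHypothesis_holds`, Titchmarsh Thm. 14.25 (A) ⇒ (C) for a
zero-free half-plane, plus `MertensDictionary.exists_bound_of_isBigO`).
[cite: Titchmarsh1986, Thm 14.25 ((A) ⇒ (C))] -/
theorem exists_mertens_bound_of_quasiRH {θ₀ : ℝ} (h0 : 1 / 2 ≤ θ₀) (h1 : θ₀ < 1)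
    (hQ : QuasiRiemannHypothesis θ₀) {ε : ℝ} (hε : 0 < ε) :
    ∃ C : ℝ, 0 ≤ C ∧ ∀ t : ℝ, 1 ≤ t →
      |∑ k ∈ Finset.Icc 0 ⌊t⌋₊, (μ k : ℝ)| ≤ C * t ^ (θ₀ + ε) := by
  have hBig := mertens_isBigO_of_quasiRiemannHypothesis_holds θ₀ h0 h1 hQ ε hε
  obtain ⟨C, hC0, hC⟩ := MertensDictionary.exists_bound_of_isBigO (by linarith) hBig
  refine ⟨C, hC0, fun t ht => ?_⟩
  have hn : 1 ≤ ⌊t⌋₊ := Nat.le_floor (by simpa using ht)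
  rw [sum_Icc_moebius_eq_mertensFunction]
  refine (hC _ hn).trans ?_
  gcongr
  exact Nat.floor_le (by linarith)

/-! ### `∑_{k ≤ x} μ(k)/k = O(x^{α-1})` -/

/-- `t ↦ M(t)/t²` is integrable on `(1, ∞)` (tree, from the classical bound on `M`). [folklore] -/
theorem integrableOn_sum_div_sq :
    IntegrableOn (fun t : ℝ => (∑ k ∈ Finset.Icc 0 ⌊t⌋₊, (μ k : ℝ)) / t ^ 2) (Set.Ioi 1) := by
  obtain ⟨c₀, hc₀, C₀, hC₀, hMb⟩ := MoebiusSum.exists_abs_sum_Icc_moebius_le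
  exact MoebiusSum.integrableOn_sum_div_sq hc₀ hC₀ hMb

/-- **`∫_1^∞ M(t) t⁻² dt = 0`** (tree; this is `∑ μ(n)/n = 0`). [folklore] -/
theorem integral_sum_div_sq_eq_zero :
    ∫ t in Set.Ioi (1 : ℝ), (∑ k ∈ Finset.Icc 0 ⌊t⌋₊, (μ k : ℝ)) / t ^ 2 = 0 := by
  obtain ⟨c₀, hc₀, C₀, hC₀, hMb⟩ := MoebiusSum.exists_abs_sum_Icc_moebius_le
  exact MoebiusSum.integral_sum_div_sq_eq_zero hc₀ hC₀ hMb

/-- **`|∑_{k ≤ x} μ(k)/k| ≤ C (1 + 1/(1-α)) x^{α-1}`** for `x ≥ 1`, from `|M(t)| ≤ C t^α`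
(`0 < α < 1`): `m(x) = M(x)/x + ∫_1^x M t⁻² = M(x)/x - ∫_x^∞ M t⁻²`. [folklore] -/
theorem abs_sum_moebius_div_le {C α : ℝ} (hα1 : α < 1)
    (hM : ∀ t : ℝ, 1 ≤ t → |∑ k ∈ Finset.Icc 0 ⌊t⌋₊, (μ k : ℝ)| ≤ C * t ^ α)
    {x : ℝ} (hx : 1 ≤ x) :
    |∑ k ∈ Finset.Icc 1 ⌊x⌋₊, (μ k : ℝ) / k| ≤ C * (1 + 1 / (1 - α)) * x ^ (α - 1) := by
  set M : ℝ → ℝ := fun t => ∑ k ∈ Finset.Icc 0 ⌊t⌋₊, (μ k : ℝ) with hMdef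
  have hx0 : 0 < x := by linarith
  rw [MoebiusSum.sum_moebius_div_eq x hx]
  -- split `∫_{Ioi 1} = ∫_{Ioc 1 x} + ∫_{Ioi x}`
  have hint : IntegrableOn (fun t : ℝ => M t / t ^ 2) (Set.Ioi 1) := integrableOn_sum_div_sq
  have hsplit : ∫ t in Set.Ioi (1 : ℝ), M t / t ^ 2 =
      (∫ t in Set.Ioc 1 x, M t / t ^ 2) + ∫ t in Set.Ioi x, M t / t ^ 2 := by
    rw [← Set.Ioc_union_Ioi_eq_Ioi hx, setIntegral_union (Set.Ioc_disjoint_Ioi le_rfl)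
      measurableSet_Ioi (hint.mono_set Set.Ioc_subset_Ioi_self)
      (hint.mono_set (Set.Ioi_subset_Ioi hx))]
  have h0 : ∫ t in Set.Ioi (1 : ℝ), M t / t ^ 2 = 0 := integral_sum_div_sq_eq_zero
  have hIoc : ∫ t in Set.Ioc 1 x, M t / t ^ 2 = -∫ t in Set.Ioi x, M t / t ^ 2 := by linarith
  -- the tail `|∫_x^∞ M t⁻²| ≤ C x^{α-1}/(1-α)`
  have htail : |∫ t in Set.Ioi x, M t / t ^ 2| ≤ C * x ^ (α - 1) / (1 - α) := by
    have hg : IntegrableOn (fun t : ℝ => C * t ^ (α - 2)) (Set.Ioi x) :=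
      (integrableOn_Ioi_rpow_of_lt (by linarith) hx0).const_mul C
    have hle := norm_integral_le_of_norm_le (f := fun t : ℝ => M t / t ^ 2) hg ?_
    · rw [Real.norm_eq_abs] at hle
      refine hle.trans (le_of_eq ?_)
      rw [integral_const_mul, integral_Ioi_rpow_of_lt (by linarith) hx0]
      rw [show α - 2 + 1 = α - 1 by ring]
      have h1α : (1 - α) ≠ 0 := by linarith
      have h2α : (α - 1) ≠ 0 := by linarith
      field_simp
      ring
    · refine ae_restrict_of_forall_mem measurableSet_Ioi fun t ht => ?_
      have ht1 : 1 ≤ t := hx.trans (le_of_lt ht)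
      have ht0 : 0 < t := by linarith
      rw [Real.norm_eq_abs, abs_div, abs_of_pos (pow_pos ht0 2), div_le_iff₀ (pow_pos ht0 2)]
      calc |M t| ≤ C * t ^ α := hM t ht1
        _ = C * t ^ (α - 2) * t ^ 2 := by
            rw [mul_assoc, ← Real.rpow_natCast, ← Real.rpow_add ht0]; norm_num
  have hmain : |M x / x| ≤ C * x ^ (α - 1) := by
    rw [abs_div, abs_of_pos hx0, div_le_iff₀ hx0]
    calc |M x| ≤ C * x ^ α := hM x hx
      _ = C * x ^ (α - 1) * x := by
          rw [mul_assoc, ← Real.rpow_add_one hx0.ne']; norm_num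
  rw [hIoc]
  calc |M x / x + -∫ t in Set.Ioi x, M t / t ^ 2|
      ≤ |M x / x| + |∫ t in Set.Ioi x, M t / t ^ 2| := by
        refine (abs_add_le _ _).trans ?_; rw [abs_neg]
    _ ≤ C * x ^ (α - 1) + C * x ^ (α - 1) / (1 - α) := add_le_add hmain htail
    _ = C * (1 + 1 / (1 - α)) * x ^ (α - 1) := by
        have : (1 - α) ≠ 0 := by linarith
        field_simp

/-! ### The tail `∑_{d > D} μ(d)/d² = O(D^{α-2})` -/

/-- **Finite tails by Abel summation**: for `1 ≤ D ≤ D'`,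
`|∑_{D < d ≤ D'} μ(d)/d²| ≤ 4 C D^{α-2}`. [folklore] -/
theorem abs_sum_Ioc_moebius_div_sq_le {C α : ℝ} (hC : 0 ≤ C) (hα1 : α < 1)
    (hM : ∀ t : ℝ, 1 ≤ t → |∑ k ∈ Finset.Icc 0 ⌊t⌋₊, (μ k : ℝ)| ≤ C * t ^ α)
    {D D' : ℕ} (hD : 1 ≤ D) (hDD' : D ≤ D') :
    |∑ d ∈ Finset.Ioc D D', (μ d : ℝ) / (d : ℝ) ^ 2| ≤ 4 * C * (D : ℝ) ^ (α - 2) := by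
  set M : ℝ → ℝ := fun t => ∑ k ∈ Finset.Icc 0 ⌊t⌋₊, (μ k : ℝ) with hMdef
  have hD0 : (0 : ℝ) < D := by exact_mod_cast hD
  have hD1 : (1 : ℝ) ≤ D := by exact_mod_cast hD
  -- Abel summation with `f(t) = (t²)⁻¹` on `[D, D']`
  set f : ℝ → ℝ := fun t => (t ^ 2)⁻¹ with hf
  have hfd : ∀ t : ℝ, t ≠ 0 → HasDerivAt f (-(2 * t) / (t ^ 2) ^ 2) t := fun t ht => by
    rw [hf]
    exact ((hasDerivAt_pow 2 t).inv (pow_ne_zero 2 ht)).congr_deriv (by norm_num)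
  have hf_diff : ∀ t ∈ Set.Icc (D : ℝ) D', DifferentiableAt ℝ f t := fun t ht =>
    (hfd t (by linarith [ht.1])).differentiableAt
  have hderiv : ∀ t : ℝ, t ≠ 0 → deriv f t = -(2 * t) / (t ^ 2) ^ 2 := fun t ht => (hfd t ht).deriv
  have hf_int : IntegrableOn (deriv f) (Set.Icc (D : ℝ) D') := by
    refine ContinuousOn.integrableOn_Icc ?_
    have hc : ContinuousOn (fun t : ℝ => -(2 * t) / (t ^ 2) ^ 2) (Set.Icc (D : ℝ) D') := by
      refine ContinuousOn.div (by fun_prop) (by fun_prop) fun t ht => ?_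
      exact pow_ne_zero 2 (pow_ne_zero 2 (by linarith [ht.1]))
    exact hc.congr fun t ht => hderiv t (by linarith [ht.1])
  have habel := sum_mul_eq_sub_sub_integral_mul' (fun k => (μ k : ℝ)) hDD' hf_diff hf_int
  have hsum : ∑ d ∈ Finset.Ioc D D', (μ d : ℝ) / (d : ℝ) ^ 2 =
      ∑ d ∈ Finset.Ioc D D', f d * (μ d : ℝ) :=
    Finset.sum_congr rfl fun d _ => by rw [hf]; ring
  rw [hsum, habel]
  -- the three terms
  have hpow : ∀ {n : ℕ}, 1 ≤ n → |f n * ∑ k ∈ Finset.Icc 0 n, (μ k : ℝ)| ≤ C * (n : ℝ) ^ (α - 2) :=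
    fun {n} hn => by
    have hn0 : (0 : ℝ) < n := by exact_mod_cast hn
    rw [hf, abs_mul]
    dsimp only
    rw [abs_inv, abs_of_pos (pow_pos hn0 2)]
    have := hM n (by exact_mod_cast hn)
    rw [Nat.floor_natCast] at this
    calc (↑n ^ 2)⁻¹ * |∑ k ∈ Finset.Icc 0 n, (μ k : ℝ)| ≤ (↑n ^ 2)⁻¹ * (C * (n : ℝ) ^ α) := by
          gcongr
      _ = C * (n : ℝ) ^ (α - 2) := by
          rw [Real.rpow_sub hn0, Real.rpow_two]; field_simp
  have hD'le : (D' : ℝ) ^ (α - 2) ≤ (D : ℝ) ^ (α - 2) :=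
    Real.rpow_le_rpow_of_nonpos hD0 (by exact_mod_cast hDD') (by linarith)
  have t1 : |f D' * ∑ k ∈ Finset.Icc 0 D', (μ k : ℝ)| ≤ C * (D : ℝ) ^ (α - 2) :=
    (hpow (hD.trans hDD')).trans (mul_le_mul_of_nonneg_left hD'le hC)
  have t2 : |f D * ∑ k ∈ Finset.Icc 0 D, (μ k : ℝ)| ≤ C * (D : ℝ) ^ (α - 2) := hpow hD
  have t3 : |∫ t in Set.Ioc (D : ℝ) D', deriv f t * M t| ≤ 2 * C * (D : ℝ) ^ (α - 2) := by
    have hg : IntegrableOn (fun t : ℝ => 2 * C * t ^ (α - 3)) (Set.Ioi (D : ℝ)) :=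
      (integrableOn_Ioi_rpow_of_lt (by linarith) hD0).const_mul _
    have hle := norm_integral_le_of_norm_le
      (f := fun t : ℝ => deriv f t * M t) (g := fun t : ℝ => 2 * C * t ^ (α - 3))
      (hg.mono_set (Set.Ioc_subset_Ioi_self : Set.Ioc (D : ℝ) D' ⊆ Set.Ioi (D : ℝ))) ?_
    · rw [Real.norm_eq_abs] at hle
      refine hle.trans ?_
      calc ∫ t in Set.Ioc (D : ℝ) D', 2 * C * t ^ (α - 3)
          ≤ ∫ t in Set.Ioi (D : ℝ), 2 * C * t ^ (α - 3) :=
            setIntegral_mono_set hg (ae_restrict_of_forall_mem measurableSet_Ioi fun t ht => by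
              have : (0:ℝ) < t := hD0.trans ht
              positivity) (ae_of_all _ Set.Ioc_subset_Ioi_self)
        _ = 2 * C * (D : ℝ) ^ (α - 2) / (2 - α) := by
            rw [integral_const_mul, integral_Ioi_rpow_of_lt (by linarith) hD0,
              show α - 3 + 1 = α - 2 by ring]
            have h1 : (2 - α) ≠ 0 := by linarith
            have h2 : (α - 2) ≠ 0 := by linarith
            field_simp
            ring
        _ ≤ 2 * C * (D : ℝ) ^ (α - 2) := by
            rw [div_le_iff₀ (by linarith)]
            have : 0 ≤ 2 * C * (D : ℝ) ^ (α - 2) := by positivity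
            nlinarith
    · refine ae_restrict_of_forall_mem measurableSet_Ioc fun t ht => ?_
      have ht0 : 0 < t := hD0.trans ht.1
      have ht1 : 1 ≤ t := hD1.trans ht.1.le
      rw [Real.norm_eq_abs, abs_mul, hderiv t ht0.ne']
      have e1 : |-(2 * t) / (t ^ 2) ^ 2| = 2 * t ^ (-3 : ℝ) := by
        rw [abs_div, abs_neg, abs_of_pos (by positivity), abs_of_pos (by positivity),
          Real.rpow_neg ht0.le, show (3 : ℝ) = ((3 : ℕ) : ℝ) by norm_num, Real.rpow_natCast]
        field_simp
      rw [e1]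
      calc 2 * t ^ (-3 : ℝ) * |M t| ≤ 2 * t ^ (-3 : ℝ) * (C * t ^ α) := by
            gcongr; exact hM t ht1
        _ = 2 * C * t ^ (α - 3) := by
            rw [show α - 3 = α + (-3) by ring, Real.rpow_add ht0]; ring
  set I : ℝ := ∫ t in Set.Ioc (D : ℝ) D', deriv f t * M t with hI
  set a₁ : ℝ := f D' * ∑ k ∈ Finset.Icc 0 D', (μ k : ℝ) with ha₁
  set a₂ : ℝ := f D * ∑ k ∈ Finset.Icc 0 D, (μ k : ℝ) with ha₂
  calc |a₁ - a₂ - I| ≤ |a₁ - a₂| + |I| := abs_sub _ _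
    _ ≤ |a₁| + |a₂| + |I| := by gcongr; exact abs_sub _ _
    _ ≤ C * (D : ℝ) ^ (α - 2) + C * (D : ℝ) ^ (α - 2) + 2 * C * (D : ℝ) ^ (α - 2) := by
        gcongr
    _ = 4 * C * (D : ℝ) ^ (α - 2) := by ring

/-- `d ↦ μ(d)/d²` is absolutely summable (real version). [folklore] -/
theorem summable_moebius_div_sq_real : Summable fun d : ℕ => (μ d : ℝ) / (d : ℝ) ^ 2 := by
  refine Summable.of_norm_bounded (Real.summable_one_div_nat_pow.mpr one_lt_two) fun d => ?_
  rw [norm_div, norm_pow, Real.norm_natCast, Real.norm_eq_abs]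
  rcases Nat.eq_zero_or_pos d with rfl | hd
  · simp
  · exact div_le_div_of_nonneg_right (by exact_mod_cast ArithmeticFunction.abs_moebius_le_one)
      (by positivity)

/-- **The tail**: `|∑_{d > D} μ(d)/d²| ≤ 4 C D^{α-2}` for `D ≥ 1` (real version). [folklore] -/
theorem abs_tsum_moebius_div_sq_tail_le {C α : ℝ} (hC : 0 ≤ C) (hα1 : α < 1)
    (hM : ∀ t : ℝ, 1 ≤ t → |∑ k ∈ Finset.Icc 0 ⌊t⌋₊, (μ k : ℝ)| ≤ C * t ^ α)
    {D : ℕ} (hD : 1 ≤ D) :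
    |(∑' d : ℕ, (μ d : ℝ) / (d : ℝ) ^ 2) - ∑ d ∈ Finset.Ioc 0 D, (μ d : ℝ) / (d : ℝ) ^ 2| ≤
      4 * C * (D : ℝ) ^ (α - 2) := by
  set f : ℕ → ℝ := fun d => (μ d : ℝ) / (d : ℝ) ^ 2 with hf
  have hs : Summable f := summable_moebius_div_sq_real
  have hsplit := hs.sum_add_tsum_nat_add (D + 1)
  have hrange : ∑ i ∈ Finset.range (D + 1), f i = ∑ d ∈ Finset.Ioc 0 D, f d := by
    rw [Finset.range_eq_Ico, show Finset.Ioc 0 D = Finset.Ico 1 (D + 1) by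
      ext; simp only [Finset.mem_Ioc, Finset.mem_Ico]; omega]
    rw [Finset.sum_eq_sum_Ico_succ_bot (Nat.succ_pos D)]
    simp [hf]
  have htail : (∑' d : ℕ, f d) - ∑ d ∈ Finset.Ioc 0 D, f d = ∑' i : ℕ, f (i + (D + 1)) := by
    rw [← hsplit, hrange]; ring
  rw [htail]
  -- partial sums of the tail are the finite tails `∑_{D < d ≤ D+n}`
  have hs' : Summable fun i : ℕ => f (i + (D + 1)) := (summable_nat_add_iff (D + 1)).mpr hs
  have hpartial : ∀ n : ℕ, ∑ i ∈ Finset.range n, f (i + (D + 1)) = ∑ d ∈ Finset.Ioc D (D + n), f d := by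
    intro n
    rw [show Finset.Ioc D (D + n) = Finset.Ico (D + 1) (D + 1 + n) by
      ext; simp only [Finset.mem_Ioc, Finset.mem_Ico]; omega, Finset.sum_Ico_eq_sum_range]
    simp only [add_tsub_cancel_left]
    refine Finset.sum_congr rfl fun i _ => ?_
    rw [add_comm]
  have hlim : Tendsto (fun n : ℕ => |∑ i ∈ Finset.range n, f (i + (D + 1))|) atTop
      (𝓝 |∑' i : ℕ, f (i + (D + 1))|) := (hs'.hasSum.tendsto_sum_nat).abs
  refine le_of_tendsto' hlim fun n => ?_
  rw [hpartial n]
  exact abs_sum_Ioc_moebius_div_sq_le hC hα1 hM hD (Nat.le_add_right D n)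

/-- The same tail bound for the complex series `∑ μ(d)/d²` used in `HorocycleZeroMode`. [folklore] -/
theorem norm_tsum_moebius_div_sq_tail_le {C α : ℝ} (hC : 0 ≤ C) (hα1 : α < 1)
    (hM : ∀ t : ℝ, 1 ≤ t → |∑ k ∈ Finset.Icc 0 ⌊t⌋₊, (μ k : ℝ)| ≤ C * t ^ α)
    {D : ℕ} (hD : 1 ≤ D) :
    ‖(∑' d : ℕ, (μ d : ℂ) / (d : ℂ) ^ 2) - ∑ d ∈ Finset.Ioc 0 D, (μ d : ℂ) / (d : ℂ) ^ 2‖ ≤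
      4 * C * (D : ℝ) ^ (α - 2) := by
  have e1 : (∑' d : ℕ, (μ d : ℂ) / (d : ℂ) ^ 2) = ((∑' d : ℕ, (μ d : ℝ) / (d : ℝ) ^ 2 : ℝ) : ℂ) := by
    rw [Complex.ofReal_tsum]; push_cast; rfl
  have e2 : ∑ d ∈ Finset.Ioc 0 D, (μ d : ℂ) / (d : ℂ) ^ 2 =
      ((∑ d ∈ Finset.Ioc 0 D, (μ d : ℝ) / (d : ℝ) ^ 2 : ℝ) : ℂ) := by
    push_cast; rfl
  rw [e1, e2, ← Complex.ofReal_sub, Complex.norm_real, Real.norm_eq_abs]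
  exact abs_tsum_moebius_div_sq_tail_le hC hα1 hM hD

/-! ### Möbius against a dilated profile: `∑ μ(d) F(d)` with `‖F'(t)‖ ≤ A/t` -/

/-- **Partial summation against a profile.** Let `|M(t)| ≤ C t^α` (`t ≥ 1`, `α > 0`), and let
`F : ℝ → ℂ` be differentiable on `[1, ∞)` with `‖F'(t)‖ ≤ A/t` there and `F = 0` on `[X, ∞)`
(`X ≥ 1`). Then for every `n ≥ X`, `‖∑_{d ≤ n} μ(d) F(d)‖ ≤ C A X^α / α`
(Abel: the sum is `-∫_1^X F'(t) M(t) dt`). [folklore] -/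
theorem norm_sum_moebius_mul_le {C α A X : ℝ} (hC : 0 ≤ C) (hα : 0 < α)
    (hM : ∀ t : ℝ, 1 ≤ t → |∑ k ∈ Finset.Icc 0 ⌊t⌋₊, (μ k : ℝ)| ≤ C * t ^ α)
    {F F' : ℝ → ℂ} (hF : ∀ t : ℝ, 1 ≤ t → HasDerivAt F (F' t) t) (hA : 0 ≤ A)
    (hF' : ∀ t : ℝ, 1 ≤ t → ‖F' t‖ ≤ A / t) (hX : 1 ≤ X) (hFX : ∀ t : ℝ, X ≤ t → F t = 0)
    {n : ℕ} (hn : X ≤ n) :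
    ‖∑ d ∈ Finset.Icc 0 n, F d * (μ d : ℂ)‖ ≤ C * A * X ^ α / α := by
  set M : ℝ → ℂ := fun t => ∑ k ∈ Finset.Icc 0 ⌊t⌋₊, (μ k : ℂ) with hMdef
  have hMreal : ∀ t : ℝ, M t = ((∑ k ∈ Finset.Icc 0 ⌊t⌋₊, (μ k : ℝ) : ℝ) : ℂ) := fun t => by
    rw [hMdef]; push_cast; rfl
  have hMn : ∀ t : ℝ, 1 ≤ t → ‖M t‖ ≤ C * t ^ α := fun t ht => by
    rw [hMreal, Complex.norm_real, Real.norm_eq_abs]; exact hM t ht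
  -- `F' = 0` beyond `X`
  have hF'0 : ∀ t : ℝ, X < t → F' t = 0 := fun t ht => by
    have h1 : HasDerivAt F (F' t) t := hF t (by linarith)
    have h2 : HasDerivAt F 0 t := by
      refine (hasDerivAt_const t (0 : ℂ)).congr_of_eventuallyEq ?_
      filter_upwards [Ioi_mem_nhds ht] with s hs using hFX s (le_of_lt hs)
    exact h1.unique h2
  -- Abel summation
  have hf_diff : ∀ t ∈ Set.Icc (1 : ℝ) n, DifferentiableAt ℝ F t := fun t ht =>
    (hF t ht.1).differentiableAt
  have hderiv : ∀ t : ℝ, 1 ≤ t → deriv F t = F' t := fun t ht => (hF t ht).deriv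
  have hf_int : IntegrableOn (deriv F) (Set.Icc (1 : ℝ) n) := by
    refine Integrable.mono' (g := fun _ => A) (integrableOn_const (by simp))
      (aestronglyMeasurable_deriv F _) ?_
    refine ae_restrict_of_forall_mem measurableSet_Icc fun t ht => ?_
    rw [hderiv t ht.1]
    refine (hF' t ht.1).trans ?_
    rw [div_le_iff₀ (by linarith [ht.1])]
    nlinarith [ht.1]
  have habel := sum_mul_eq_sub_integral_mul₀ (fun k => (μ k : ℂ)) (by simp) (n : ℝ) hf_diff hf_int
  rw [Nat.floor_natCast] at habel
  have hFn : F n = 0 := hFX n hn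
  rw [habel, hFn, zero_mul, zero_sub, norm_neg]
  -- bound the integral by the majorant `CA t^{α-1}` on `(1, X]`, `0` beyond
  have hXn : Set.Ioc (1 : ℝ) n = Set.Ioc 1 X ∪ Set.Ioc X n := (Set.Ioc_union_Ioc_eq_Ioc hX hn).symm
  set gm : ℝ → ℝ := (Set.Iic X).indicator fun t => C * A * t ^ (α - 1) with hgm
  have hgi0 : IntegrableOn (fun t : ℝ => C * A * t ^ (α - 1)) (Set.Ioc 1 X) := by
    refine (ContinuousOn.integrableOn_Icc ?_).mono_set Set.Ioc_subset_Icc_self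
    exact ContinuousOn.mul continuousOn_const (continuousOn_id.rpow_const fun t ht =>
      Or.inl (by linarith [ht.1] : (t:ℝ) ≠ 0))
  have hgi : IntegrableOn gm (Set.Ioc (1 : ℝ) n) := by
    rw [hgm, integrableOn_indicator_iff measurableSet_Iic]
    refine hgi0.mono_set ?_
    intro t ht
    simp only [Set.mem_inter_iff, Set.mem_Iic, Set.mem_Ioc] at ht ⊢
    exact ⟨ht.2.1, ht.1⟩
  have hle := norm_integral_le_of_norm_le (f := fun t : ℝ => deriv F t * M t) (g := gm) hgi ?_
  · refine hle.trans ?_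
    have hint : ∫ t in Set.Ioc (1 : ℝ) n, gm t = ∫ t in Set.Ioc (1 : ℝ) X, C * A * t ^ (α - 1) := by
      rw [hgm, integral_indicator measurableSet_Iic, Measure.restrict_restrict measurableSet_Iic]
      congr 1
      rw [show Set.Iic X ∩ Set.Ioc 1 (n : ℝ) = Set.Ioc 1 X by
        ext t; simp only [Set.mem_inter_iff, Set.mem_Iic, Set.mem_Ioc]
        constructor
        · rintro ⟨h1, h2, -⟩; exact ⟨h2, h1⟩
        · rintro ⟨h1, h2⟩; exact ⟨h2, h1, h2.trans hn⟩]
    rw [hint, ← intervalIntegral.integral_of_le hX, intervalIntegral.integral_const_mul,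
      integral_rpow (Or.inl (by linarith))]
    rw [show α - 1 + 1 = α by ring, Real.one_rpow]
    rw [mul_div_assoc]
    gcongr
    linarith
  · refine ae_restrict_of_forall_mem measurableSet_Ioc fun t ht => ?_
    have ht1 : 1 ≤ t := ht.1.le
    have ht0 : 0 < t := by linarith
    rw [hderiv t ht1, hgm, Set.indicator_apply]
    split_ifs with htX
    · rw [norm_mul]
      calc ‖F' t‖ * ‖M t‖ ≤ (A / t) * (C * t ^ α) :=
            mul_le_mul (hF' t ht1) (hMn t ht1) (norm_nonneg _) (by positivity)
        _ = C * A * t ^ (α - 1) := by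
            rw [Real.rpow_sub_one ht0.ne']; field_simp
    · rw [Set.mem_Iic, not_le] at htX
      rw [hF'0 t htX, zero_mul, norm_zero]

/-! ### Abel summation against `∑_{d ≤ x} μ(d)/d` -/

/-- The complex sums `∑_{0 ≤ d ≤ ⌊t⌋} μ(d)/d` are the real sums `∑_{1 ≤ d ≤ ⌊t⌋} μ(d)/d`. [folklore] -/
theorem sum_Icc_moebius_div_cast (n : ℕ) :
    ∑ d ∈ Finset.Icc 0 n, (μ d : ℂ) / d = ((∑ d ∈ Finset.Icc 1 n, (μ d : ℝ) / d : ℝ) : ℂ) := by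
  rw [Finset.Icc_eq_cons_Ioc (Nat.zero_le _), Finset.sum_cons,
    show Finset.Ioc 0 n = Finset.Icc 1 n by ext; simp only [Finset.mem_Ioc, Finset.mem_Icc]; omega]
  push_cast
  simp

/-- **Abel summation against `m(x) = ∑_{d ≤ x} μ(d)/d = O(x^{α-1})`.** If
`|∑_{d ≤ x} μ(d)/d| ≤ C_m x^{α-1}` (`x ≥ 1`, `α > 0`) and `f` is `C¹` on `[1, D]` (`D ≥ 1`) with
`‖f(D)‖ ≤ B₀` and `‖f'‖ ≤ B₁` there, then
`‖∑_{1 ≤ d ≤ D} (μ(d)/d) f(d)‖ ≤ B₀ C_m D^{α-1} + (B₁ C_m/α) D^α`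
(`∑ = f(D) m(D) - ∫_1^D f' m`). [folklore] -/
theorem norm_sum_moebius_div_mul_le {Cm α : ℝ} (hCm : 0 ≤ Cm) (hα0 : 0 < α)
    (hm : ∀ x : ℝ, 1 ≤ x → |∑ n ∈ Finset.Icc 1 ⌊x⌋₊, (μ n : ℝ) / n| ≤ Cm * x ^ (α - 1))
    {f f' : ℝ → ℂ} {D : ℕ} (hD : 1 ≤ D) (hf : ∀ t ∈ Set.Icc (1 : ℝ) D, HasDerivAt f (f' t) t)
    (hf'c : ContinuousOn f' (Set.Icc (1 : ℝ) D)) {B₀ B₁ : ℝ} (hB₀ : ‖f D‖ ≤ B₀) (hB₁0 : 0 ≤ B₁)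
    (hB₁ : ∀ t ∈ Set.Icc (1 : ℝ) D, ‖f' t‖ ≤ B₁) :
    ‖∑ d ∈ Finset.Ioc 0 D, ((μ d : ℂ) / d) * f d‖ ≤
      B₀ * (Cm * (D : ℝ) ^ (α - 1)) + (B₁ * Cm / α) * (D : ℝ) ^ α := by
  have hD1 : (1 : ℝ) ≤ D := by exact_mod_cast hD
  set c : ℕ → ℂ := fun d => (μ d : ℂ) / d with hc
  have hc0 : c 0 = 0 := by simp [hc]
  have hshape : ∑ d ∈ Finset.Ioc 0 D, ((μ d : ℂ) / d) * f d = ∑ d ∈ Finset.Icc 0 D, f d * c d := by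
    rw [Finset.Icc_eq_cons_Ioc (Nat.zero_le D), Finset.sum_cons, hc0, mul_zero, zero_add]
    exact Finset.sum_congr rfl fun d _ => by rw [hc, mul_comm]
  rw [hshape]
  -- Abel summation
  have hf_diff : ∀ t ∈ Set.Icc (1 : ℝ) D, DifferentiableAt ℝ f t := fun t ht =>
    (hf t ht).differentiableAt
  have hderiv : ∀ t ∈ Set.Icc (1 : ℝ) D, deriv f t = f' t := fun t ht => (hf t ht).deriv
  have hf_int : IntegrableOn (deriv f) (Set.Icc (1 : ℝ) D) :=
    (ContinuousOn.integrableOn_Icc (hf'c.congr hderiv))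
  have habel := sum_mul_eq_sub_integral_mul₀ c hc0 (D : ℝ) hf_diff hf_int
  rw [Nat.floor_natCast] at habel
  rw [habel]
  -- the summatory function of `c`
  have hmc : ∀ t : ℝ, 1 ≤ t → ‖∑ d ∈ Finset.Icc 0 ⌊t⌋₊, c d‖ ≤ Cm * t ^ (α - 1) := fun t ht => by
    have e : ∑ d ∈ Finset.Icc 0 ⌊t⌋₊, c d = ((∑ d ∈ Finset.Icc 1 ⌊t⌋₊, (μ d : ℝ) / d : ℝ) : ℂ) :=
      sum_Icc_moebius_div_cast _
    rw [e, Complex.norm_real, Real.norm_eq_abs]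
    exact hm t ht
  -- boundary term
  have hbdry : ‖f D * ∑ d ∈ Finset.Icc 0 D, c d‖ ≤ B₀ * (Cm * (D : ℝ) ^ (α - 1)) := by
    rw [norm_mul]
    have h2 : ‖∑ d ∈ Finset.Icc 0 D, c d‖ ≤ Cm * (D : ℝ) ^ (α - 1) := by
      have := hmc D hD1
      rwa [Nat.floor_natCast] at this
    exact mul_le_mul hB₀ h2 (norm_nonneg _) ((norm_nonneg _).trans hB₀)
  -- integral term
  have hint : ‖∫ t in Set.Ioc (1 : ℝ) D, deriv f t * ∑ d ∈ Finset.Icc 0 ⌊t⌋₊, c d‖ ≤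
      (B₁ * Cm / α) * (D : ℝ) ^ α := by
    have hg : IntegrableOn (fun t : ℝ => B₁ * Cm * t ^ (α - 1)) (Set.Ioc (1 : ℝ) D) := by
      refine (ContinuousOn.integrableOn_Icc ?_).mono_set Set.Ioc_subset_Icc_self
      exact ContinuousOn.mul continuousOn_const (continuousOn_id.rpow_const fun t ht =>
        Or.inl (by linarith [ht.1] : (t:ℝ) ≠ 0))
    have hle := norm_integral_le_of_norm_le
      (f := fun t : ℝ => deriv f t * ∑ d ∈ Finset.Icc 0 ⌊t⌋₊, c d) hg ?_
    · refine hle.trans ?_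
      rw [← intervalIntegral.integral_of_le hD1, intervalIntegral.integral_const_mul,
        integral_rpow (Or.inl (by linarith)), show α - 1 + 1 = α by ring, Real.one_rpow]
      rw [show B₁ * Cm * ((↑D ^ α - 1) / α) = (B₁ * Cm / α) * (D : ℝ) ^ α - (B₁ * Cm / α) by
        field_simp]
      have : 0 ≤ B₁ * Cm / α := by positivity
      linarith
    · refine ae_restrict_of_forall_mem measurableSet_Ioc fun t ht => ?_
      have ht1 : 1 ≤ t := ht.1.le
      have htI : t ∈ Set.Icc (1 : ℝ) D := ⟨ht1, ht.2⟩
      rw [hderiv t htI, norm_mul]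
      calc ‖f' t‖ * ‖∑ d ∈ Finset.Icc 0 ⌊t⌋₊, c d‖ ≤ B₁ * (Cm * t ^ (α - 1)) :=
            mul_le_mul (hB₁ t htI) (hmc t ht1) (norm_nonneg _) hB₁0
        _ = B₁ * Cm * t ^ (α - 1) := by ring
  calc ‖f D * ∑ d ∈ Finset.Icc 0 D, c d -
        ∫ t in Set.Ioc (1 : ℝ) D, deriv f t * ∑ d ∈ Finset.Icc 0 ⌊t⌋₊, c d‖
      ≤ ‖f D * ∑ d ∈ Finset.Icc 0 D, c d‖ +
        ‖∫ t in Set.Ioc (1 : ℝ) D, deriv f t * ∑ d ∈ Finset.Icc 0 ⌊t⌋₊, c d‖ := norm_sub_le _ _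
    _ ≤ _ := add_le_add hbdry hint

end MoebiusDilatedSums

end Literature.NumberTheory.LFunctions

end
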